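import Summits.ResolutionOfSingularities.ResolutionOfSingularities.Theorems.FrobeniusClosingSteerLowTowerMoves
import Mathlib.RingTheory.LocalRing.ResidueField.Basic
import Mathlib.Algebra.Polynomial.AlgebraMap
import HarnessLib

/-!
# D3a part 4 (A1): the local ring `Λ = R_{P₀}` of a member at the critical prime, inside `K`, and its residue map
(res-D-pv-012 AS res-L0-w41-stub-8; W4.1 crux `Steer`, LOW branch, strat-2 §σ2.24; RULING 42 (A1).) OURS; AI.

For a subring `R` of a field `K` and a prime `P` of `R`: a subring `Λ ⊆ K` with `R ≤ Λ`, `r⁻¹ ∈ Λ` for `r ∈ R ∖ P`, all of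
whose elements are fractions `a / u` (`a ∈ R`, `u ∈ R ∖ P`) EXISTS (`exists_subring_locAtPrime`), and any such `Λ` is a local ring
whose non-units from `R` are exactly `P` (`isUnit_div_iff`, `isLocalRing_of_locAtPrime`, `not_isUnit_iff_mem`); its residue field
is the field of fractions of the image of `R` (`exists_residue_div_eq`, `residue_eq_zero_iff_mem`). This is the frame (Λ1)–(Λ4) of
the LOW tower (`Λ := (R i₀)_{P₀}`, `φ :=` the residue map of `Λ`, `κ := κ(P₀)`).
-/

noncomputable section
set_option linter.dupNamespace false

namespace Summit.ResolutionOfSingularities.ResolutionOfSingularities.Theorems.SwitchingDichotomy.LowTower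

open IsLocalRing
open Literature.AlgebraicGeometry.Resolution

variable {K : Type} [Field K]

/-- **Existence of `R_P` inside `K`**: the fractions `a / u` with `a ∈ R`, `u ∈ R ∖ P` form a subring `Λ` of `K` containing `R` and
the inverses of the elements of `R ∖ P`. [folklore] -/
theorem exists_subring_locAtPrime (R : Subring K) (P : Ideal R) [hP : P.IsPrime] :
    ∃ Λ : Subring K, R ≤ Λ ∧ (∀ r (hr : r ∈ R), (⟨r, hr⟩ : R) ∉ P → r⁻¹ ∈ Λ) ∧
      ∀ z ∈ Λ, ∃ a u : K, ∃ (_ : a ∈ R) (hu : u ∈ R), (⟨u, hu⟩ : R) ∉ P ∧ z = a / u := by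
  have h1P : (1 : R) ∉ P := fun h => hP.ne_top (P.eq_top_iff_one.mpr h)
  have hne0 : ∀ u (hu : u ∈ R), (⟨u, hu⟩ : R) ∉ P → (u : K) ≠ 0 := by
    rintro u hu huP rfl
    exact huP (by rw [show (⟨(0 : K), hu⟩ : R) = 0 from Subtype.ext rfl]; exact P.zero_mem)
  let Λ : Subring K :=
    { carrier := {z | ∃ a u : K, ∃ (ha : a ∈ R) (hu : u ∈ R), (⟨u, hu⟩ : R) ∉ P ∧ z = a / u}
      mul_mem' := by
        rintro _ _ ⟨a, u, ha, hu, huP, rfl⟩ ⟨b, v, hb, hv, hvP, rfl⟩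
        refine ⟨a * b, u * v, R.mul_mem ha hb, R.mul_mem hu hv, fun h => ?_, by rw [div_mul_div_comm]⟩
        rcases hP.mem_or_mem (x := ⟨u, hu⟩) (y := ⟨v, hv⟩) h with h | h
        exacts [huP h, hvP h]
      one_mem' := ⟨1, 1, R.one_mem, R.one_mem, h1P, by simp⟩
      add_mem' := by
        rintro _ _ ⟨a, u, ha, hu, huP, rfl⟩ ⟨b, v, hb, hv, hvP, rfl⟩
        refine ⟨a * v + u * b, u * v, R.add_mem (R.mul_mem ha hv) (R.mul_mem hu hb), R.mul_mem hu hv,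
          fun h => ?_, by rw [div_add_div _ _ (hne0 u hu huP) (hne0 v hv hvP)]⟩
        rcases hP.mem_or_mem (x := ⟨u, hu⟩) (y := ⟨v, hv⟩) h with h | h
        exacts [huP h, hvP h]
      zero_mem' := ⟨0, 1, R.zero_mem, R.one_mem, h1P, by simp⟩
      neg_mem' := by
        rintro _ ⟨a, u, ha, hu, huP, rfl⟩
        exact ⟨-a, u, R.neg_mem ha, hu, huP, by rw [neg_div]⟩ }
  refine ⟨Λ, fun r hr => ⟨r, 1, hr, R.one_mem, h1P, by simp⟩,
    fun r hr hrP => ⟨1, r, R.one_mem, hr, hrP, by rw [inv_eq_one_div]⟩, fun z hz => hz⟩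

section Frame

variable (R Λ : Subring K) (P : Ideal R) [hP : P.IsPrime] (h1 : R ≤ Λ)
  (h2 : ∀ r (hr : r ∈ R), (⟨r, hr⟩ : R) ∉ P → r⁻¹ ∈ Λ)
  (h4 : ∀ z ∈ Λ, ∃ a u : K, ∃ (_ : a ∈ R) (hu : u ∈ R), (⟨u, hu⟩ : R) ∉ P ∧ z = a / u)

omit hP in
/-- An element of `R ∖ P` is non-zero. [folklore] -/
theorem ne_zero_of_not_mem {u : K} (hu : u ∈ R) (huP : (⟨u, hu⟩ : R) ∉ P) : u ≠ 0 := by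
  rintro rfl
  exact huP (by rw [show (⟨(0 : K), hu⟩ : R) = 0 from Subtype.ext rfl]; exact P.zero_mem)

omit hP in
include h2 in
/-- An element of `R ∖ P` is a unit of `Λ`. [folklore] -/
theorem isUnit_of_not_mem {u : K} (hu : u ∈ R) (huP : (⟨u, hu⟩ : R) ∉ P) : IsUnit (⟨u, h1 hu⟩ : Λ) := by
  have hu0 : u ≠ 0 := ne_zero_of_not_mem R P hu huP
  exact IsUnit.of_mul_eq_one (b := ⟨u⁻¹, h2 u hu huP⟩) (Subtype.ext (by simp [hu0]))

include h1 h2 h4 in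
/-- **Units of `Λ = R_P`**: `a / u` (`a ∈ R`, `u ∈ R ∖ P`) is a unit of `Λ` iff `a ∉ P`. [folklore] -/
theorem isUnit_div_iff {a u : K} (ha : a ∈ R) (hu : u ∈ R) (huP : (⟨u, hu⟩ : R) ∉ P) (hz : a / u ∈ Λ) :
    IsUnit (⟨a / u, hz⟩ : Λ) ↔ (⟨a, ha⟩ : R) ∉ P := by
  have hu0 : u ≠ 0 := ne_zero_of_not_mem R P hu huP
  constructor
  · intro hunit haP
    obtain ⟨w, hw⟩ := hunit.exists_right_inv
    obtain ⟨b, v, hb, hv, hvP, hwv⟩ := h4 (w : K) w.2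
    have hv0 : v ≠ 0 := ne_zero_of_not_mem R P hv hvP
    have hK : a / u * (b / v) = 1 := by
      have := congrArg Subtype.val hw
      simpa [hwv] using this
    have hab : a * b = u * v := by
      field_simp at hK
      linear_combination hK
    have hmem : (⟨u, hu⟩ : R) * ⟨v, hv⟩ ∈ P := by
      have : (⟨u, hu⟩ : R) * ⟨v, hv⟩ = ⟨a, ha⟩ * ⟨b, hb⟩ := Subtype.ext (by simpa using hab.symm)
      rw [this]
      exact P.mul_mem_right _ haP
    rcases hP.mem_or_mem hmem with h | h
    exacts [huP h, hvP h]
  · intro haP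
    have ha0 : a ≠ 0 := ne_zero_of_not_mem R P ha haP
    refine IsUnit.of_mul_eq_one (b := ⟨u * a⁻¹, Λ.mul_mem (h1 hu) (h2 a ha haP)⟩) (Subtype.ext ?_)
    simp only [Subring.coe_mul, Subring.coe_one]
    field_simp

include hP h1 h2 h4 in
/-- **`Λ = R_P` is a local ring.** [folklore] -/
theorem isLocalRing_of_locAtPrime : IsLocalRing Λ := by
  refine IsLocalRing.of_nonunits_add ?_
  intro z w hz hw
  obtain ⟨a, u, ha, hu, huP, hza⟩ := h4 (z : K) z.2
  obtain ⟨b, v, hb, hv, hvP, hwb⟩ := h4 (w : K) w.2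
  have hu0 : u ≠ 0 := ne_zero_of_not_mem R P hu huP
  have hv0 : v ≠ 0 := ne_zero_of_not_mem R P hv hvP
  have haP : (⟨a, ha⟩ : R) ∈ P := by
    by_contra haP
    have hz' : z = ⟨a / u, hza ▸ z.2⟩ := Subtype.ext hza
    exact hz (hz' ▸ (isUnit_div_iff R Λ P h1 h2 h4 ha hu huP _).mpr haP)
  have hbP : (⟨b, hb⟩ : R) ∈ P := by
    by_contra hbP
    have hw' : w = ⟨b / v, hwb ▸ w.2⟩ := Subtype.ext hwb
    exact hw (hw' ▸ (isUnit_div_iff R Λ P h1 h2 h4 hb hv hvP _).mpr hbP)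
  have hsum : ((z + w : Λ) : K) = (a * v + u * b) / (u * v) := by
    rw [Subring.coe_add, hza, hwb, div_add_div _ _ hu0 hv0]
  have hmem : (a * v + u * b) / (u * v) ∈ Λ := hsum ▸ (z + w).2
  have huvP : (⟨u * v, R.mul_mem hu hv⟩ : R) ∉ P := by
    intro h
    rcases hP.mem_or_mem (show (⟨u, hu⟩ : R) * ⟨v, hv⟩ ∈ P from h) with h | h
    exacts [huP h, hvP h]
  have hzw : z + w = ⟨_, hmem⟩ := Subtype.ext hsum
  rw [mem_nonunits_iff, hzw, isUnit_div_iff R Λ P h1 h2 h4 (R.add_mem (R.mul_mem ha hv) (R.mul_mem hu hb)) (R.mul_mem hu hv) huvP,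
    not_not]
  have heq : (⟨a * v + u * b, R.add_mem (R.mul_mem ha hv) (R.mul_mem hu hb)⟩ : R) =
      ⟨a, ha⟩ * ⟨v, hv⟩ + ⟨u, hu⟩ * ⟨b, hb⟩ := Subtype.ext rfl
  rw [heq]
  exact P.add_mem (P.mul_mem_right _ haP) (P.mul_mem_left _ hbP)

include h2 h4 in
/-- **Non-units of `Λ` from `R` are exactly `P`.** [folklore] -/
theorem not_isUnit_iff_mem (r : R) : ¬ IsUnit (⟨(r : K), h1 r.2⟩ : Λ) ↔ r ∈ P := by
  have h1P : (1 : R) ∉ P := fun h => hP.ne_top (P.eq_top_iff_one.mpr h)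
  have hr1 : (r : K) / 1 ∈ Λ := by simpa using h1 r.2
  have key := isUnit_div_iff R Λ P h1 h2 h4 r.2 R.one_mem h1P hr1
  have heq : (⟨(r : K), h1 r.2⟩ : Λ) = ⟨(r : K) / 1, hr1⟩ := Subtype.ext (by simp)
  rw [heq, key, not_not]

include h2 h4 in
/-- **The residue map of `Λ` kills exactly `P` on `R`.** [folklore] -/
theorem residue_eq_zero_iff_mem [IsLocalRing Λ] (r : R) : residue Λ ⟨(r : K), h1 r.2⟩ = 0 ↔ r ∈ P := by
  rw [residue_eq_zero_iff, mem_maximalIdeal, mem_nonunits_iff, not_isUnit_iff_mem R Λ P h1 h2 h4 r]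

/-- The residue map of a local ring kills only non-units (the `hker` input of the images frame). [folklore] -/
theorem not_isUnit_of_residue_eq_zero (S : Type*) [CommRing S] [IsLocalRing S] (r : S) (hr : residue S r = 0) : ¬ IsUnit r := by
  rw [residue_eq_zero_iff, mem_maximalIdeal, mem_nonunits_iff] at hr
  exact hr

omit hP in
include h2 h4 in
/-- **The residue field of `Λ = R_P` consists of fractions of residues of elements of `R`** (`κ(P) = Frac (R ⧸ P)` read in
`Λ / 𝔪_Λ`). [folklore] -/
theorem exists_residue_div_eq [IsLocalRing Λ] (z : ResidueField Λ) :
    ∃ a u : K, ∃ (ha : a ∈ R) (hu : u ∈ R), (⟨u, hu⟩ : R) ∉ P ∧ residue Λ ⟨u, h1 hu⟩ ≠ 0 ∧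
      z = residue Λ ⟨a, h1 ha⟩ / residue Λ ⟨u, h1 hu⟩ := by
  obtain ⟨w, rfl⟩ := residue_surjective z
  obtain ⟨a, u, ha, hu, huP, hw⟩ := h4 (w : K) w.2
  have hu0 : u ≠ 0 := ne_zero_of_not_mem R P hu huP
  have hunit : IsUnit (⟨u, h1 hu⟩ : Λ) := isUnit_of_not_mem R Λ P h1 h2 hu huP
  have hres0 : residue Λ ⟨u, h1 hu⟩ ≠ 0 := by
    rw [Ne, residue_eq_zero_iff, mem_maximalIdeal, mem_nonunits_iff, not_not]
    exact hunit
  refine ⟨a, u, ha, hu, huP, hres0, ?_⟩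
  rw [eq_div_iff hres0, ← map_mul]
  congr 1
  exact Subtype.ext (by simp [hw, hu0])

omit hP in
include h1 h2 h4 in
/-- **`κ(P)` is the field of fractions of the image of `R`**: with `φ` the residue map of `Λ`, every element of the residue field
is a quotient of two elements of `φ(R)`. [folklore] -/
theorem isFractionRing_map_residue [IsLocalRing Λ] :
    IsFractionRing ((R.comap Λ.subtype).map (residue Λ : Λ →+* ResidueField Λ)) (ResidueField Λ) := by
  refine IsFractionRing.of_field _ _ (fun z => ?_)
  obtain ⟨a, u, ha, hu, huP, -, hz⟩ := exists_residue_div_eq R Λ P h1 h2 h4 z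
  refine ⟨⟨residue Λ ⟨a, h1 ha⟩, (mem_map_comap_iff Λ _ R _).mpr ⟨⟨a, h1 ha⟩, ha, rfl⟩⟩,
    ⟨residue Λ ⟨u, h1 hu⟩, (mem_map_comap_iff Λ _ R _).mpr ⟨⟨u, h1 hu⟩, hu, rfl⟩⟩, ?_⟩
  exact hz

end Frame

section ZeroDim

variable {k κ : Type} [Field k] [Field κ] [Algebra k K] [Algebra k κ]

/-- A member of a subring of a field is a unit iff it is non-zero with inverse in the subring. [folklore] -/
theorem isUnit_subring_iff {L : Type} [Field L] (S : Subring L) (x : S) : IsUnit x ↔ (x : L) ≠ 0 ∧ (x : L)⁻¹ ∈ S := by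
  constructor
  · intro hx
    have hx0 : (x : L) ≠ 0 := by
      obtain ⟨y, hy⟩ := hx.exists_right_inv
      intro h0
      have := congrArg Subtype.val hy
      simp [h0] at this
    obtain ⟨y, hy⟩ := hx.exists_right_inv
    have hyK : (y : L) = (x : L)⁻¹ := by
      have := congrArg Subtype.val hy
      simp only [Subring.coe_mul, Subring.coe_one] at this
      exact (eq_inv_of_mul_eq_one_right this)
    exact ⟨hx0, hyK ▸ y.2⟩
  · rintro ⟨hx0, hinv⟩
    exact IsUnit.of_mul_eq_one (b := ⟨(x : L)⁻¹, hinv⟩) (Subtype.ext (by simp [hx0]))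

/-- **Residue classes of a member are algebraic over `k` (push-forward of `ZeroDim`)**: if `R ≤ O` for a valuation ring `O` all of
whose elements are roots modulo `𝔪_O` of non-zero polynomials over `k`, `R ≤ Λ` contains `k`, and `φ : Λ → κ` is a `k`-compatible ring
map, then every element of a `k`-subalgebra `A ⊆ κ` with underlying ring `φ(R)` is a root of a non-zero polynomial
over `k` modulo the non-units of `A`. [folklore] -/
theorem exists_aeval_not_isUnit (Λ : Subring K) (φ : Λ →+* κ)
    (hkΛ : ∀ c : k, algebraMap k K c ∈ Λ) (hφ : ∀ c : k, φ ⟨algebraMap k K c, hkΛ c⟩ = algebraMap k κ c)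
    (O : ValuationSubring K) (hzd : ∀ x ∈ O, ∃ f : Polynomial k, f ≠ 0 ∧ Polynomial.aeval x f ∈ O.nonunits)
    (R : Subring K) [IsLocalRing R] (hR : R ≤ Λ) (hRO : R ≤ O.toSubring) (hkR : ∀ c : k, algebraMap k K c ∈ R)
    (A : Subalgebra k κ) (hA : A.toSubring = (R.comap Λ.subtype).map φ) (a : A) :
    ∃ f : Polynomial k, f ≠ 0 ∧ ¬ IsUnit (Polynomial.aeval a f) := by
  have haA : (a : κ) ∈ (R.comap Λ.subtype).map φ := by rw [← hA]; exact a.2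
  obtain ⟨r, hrR, hra⟩ := (mem_map_comap_iff Λ φ R _).mp haA
  obtain ⟨f, hf0, hf⟩ := hzd (r : K) (hRO hrR)
  refine ⟨f, hf0, fun hunit => ?_⟩
  -- the polynomial value upstairs, as an element of `R`
  let iR : k →+* R := (algebraMap k K).codRestrict R hkR
  let e : R := Polynomial.eval₂ iR ⟨(r : K), hrR⟩ f
  have heK : (e : K) = Polynomial.aeval (r : K) f := by
    change R.subtype (Polynomial.eval₂ iR ⟨(r : K), hrR⟩ f) = _
    rw [Polynomial.hom_eval₂, Polynomial.aeval_def]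
    rfl
  -- its image under `φ` is the polynomial value downstairs
  have hφe : φ ⟨(e : K), hR e.2⟩ = Polynomial.aeval (a : κ) f := by
    have h1 : (⟨(e : K), hR e.2⟩ : Λ) = Polynomial.eval₂ ((Subring.inclusion hR).comp iR) ⟨(r : K), hR hrR⟩ f := by
      change Subring.inclusion hR (Polynomial.eval₂ iR ⟨(r : K), hrR⟩ f) = _
      rw [Polynomial.hom_eval₂]
      rfl
    rw [h1, Polynomial.hom_eval₂, Polynomial.aeval_def, ← hra]
    congr 1
    ext c
    exact hφ c
  -- `e` is a non-unit of `R` (it is a non-unit of `O ⊇ R`)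
  have heR : ¬ IsUnit e := by
    intro he
    obtain ⟨w, hw⟩ := he.exists_right_inv
    have hval : O.valuation (e : K) * O.valuation (w : K) = 1 := by
      rw [← map_mul, show (e : K) * (w : K) = 1 from by simpa using congrArg Subtype.val hw, map_one]
    have hle : O.valuation (w : K) ≤ 1 := (O.valuation_le_one_iff _).mpr (hRO w.2)
    have hlt : O.valuation (e : K) < 1 := by rw [heK]; exact (O.mem_nonunits_iff).mp hf
    have : O.valuation (e : K) * O.valuation (w : K) < 1 := by
      calc O.valuation (e : K) * O.valuation (w : K) ≤ O.valuation (e : K) * 1 := by gcongr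
        _ < 1 := by simpa using hlt
    exact absurd hval this.ne
  -- hence its image is a non-unit of `φ(R)`, i.e. of `A`
  have hunit' : IsUnit (⟨Polynomial.aeval (a : κ) f, by
      rw [← hφe]; exact (mem_map_comap_iff Λ φ R _).mpr ⟨⟨(e : K), hR e.2⟩, e.2, rfl⟩⟩ : (R.comap Λ.subtype).map φ) := by
    rw [isUnit_subring_iff]
    have h := (isUnit_subring_iff A.toSubring ⟨(Polynomial.aeval a f : A), (Polynomial.aeval a f).2⟩).mp
      (by
        obtain ⟨y, hy⟩ := hunit.exists_right_inv
        exact IsUnit.of_mul_eq_one (b := ⟨(y : κ), y.2⟩) (Subtype.ext (by simpa using congrArg Subtype.val hy)))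
    change Polynomial.aeval (a : κ) f ≠ 0 ∧ (Polynomial.aeval (a : κ) f)⁻¹ ∈ (R.comap Λ.subtype).map φ
    rw [← hA]
    simpa [Polynomial.coe_aeval_eq_eval] using h
  obtain ⟨ψ, hψs, hψ⟩ := exists_surjective_restrict Λ φ R hR
  haveI : IsLocalRing ((R.comap Λ.subtype).map φ) := isLocalRing_map Λ φ R hR
  haveI := IsLocalHom.of_surjective ψ hψs
  have hψe : ψ e = ⟨Polynomial.aeval (a : κ) f, by
      rw [← hφe]; exact (mem_map_comap_iff Λ φ R _).mpr ⟨⟨(e : K), hR e.2⟩, e.2, rfl⟩⟩ :=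
    Subtype.ext (by rw [hψ e]; exact hφe)
  exact heR ((isUnit_map_iff ψ e).mp (hψe ▸ hunit'))

end ZeroDim

end Summit.ResolutionOfSingularities.ResolutionOfSingularities.Theorems.SwitchingDichotomy.LowTower

end
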